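import Literature.AlgebraicGeometry.AbelianSchemes.RoofImageLineCount
import HarnessLib

/-!
# The IMAGE LINE count `#Img = n` in PREDICATE FORM (companion of ★ `RoofImageLineCount`)

Topic `AlgebraicGeometry/AbelianSchemes`, namespace `Literature.AlgebraicGeometry.AbelianSchemes.AbelianSchemeOver`.  THEOREMS ONLY (no definition, no named fact,
no `instance`, no notation, no `sorry`).  Cell `hodgecm-mathlib`, F0∕P6 line L2; DAYLIGHT head-room cure of the «M-151» (6) debt row
`…F0P6aLineSpecialisation.imgLineOfRoof_isLine` (★ `Theorems/F0P6aSpecOrgansUBlockJ.lean`, 87.7 % of its heartbeat cap), LA2-p01 (g6) for pen LA2-plan (g6) DEAL 3,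
2026-09-03.  Count-neutral: HC_CM is proved only modulo the cell's 2 remaining named inputs (hLiu418 24832, h413 24833) until rung 0 closes; this file is generic and
discharges none of them.

## Mathematics

Exactly ★ `natCard_imgLine_eq_of_sq` ([Liu2021] Prop. D.8 (1)(2); [MumfordAV1970] §7 Thm. 4): for an isogeny roof `A —q→ B ←c— A″` with `𝒪`-actions `ι, ι″`, comaximal
`𝔭 + 𝔞 = 𝒪`, rows (r1) `q P = 1 ↔ P ∈ Ker`, (r2) `c P″ = 1 ↔ ι″(𝔭)P″ = 1`, `c` onto, (r4) common intertwiners, the image line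
`Img = {P″ ∈ A″[𝔞] | ∃ P ∈ A[𝔞], c P″ = q P}` has `#Img = n` as soon as `#A[𝔞] = n·n` and `#(Ker ∩ A[𝔞]) = n`, `0 < n`.

## Why a second form

★ `natCard_imgLine_eq_of_sq` takes `Ker`, `Ker ∩ A[𝔞]` and `Img` as `Subgroup (A.toAffine.toAbelianVariety.Points Ω)`-typed data.  A caller whose point groups
are a DEFINITIONAL but not syntactic copy of that carrier (the P6a generic-fibre reading `fibreΩOf … = ((…).fibre _).toAbelianVariety` versus
`(schΩOf …).toAffine.toAbelianVariety`) pays ≈ 74 k heartbeats per `Subgroup`-typed argument, because unifying `Subgroup X = Subgroup Y` makes the elaborator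
unfold the two `Group (….Points Ω)` instances (measured: carrier `rfl` 3.8 k, `Subgroup` `rfl` 111 k, instance `HEq.rfl` 77 k; LA2-p01 (g6) probes
`F0/P6/L2/LA2-p01/g6/hb/`).  The form below takes the three pieces as PREDICATES on points with their membership formulas and the two counts as SUBTYPE
counts, and rebuilds the three subgroups internally from the roof rows (closure = multiplicativity of `q`, `c`, `ι`, `ι″` on points, ★ `map_pt_one'`,
`map_pt_mul'`, `map_pt_inv'`); callers then cross only at points and subtypes (≈ 4–6 k each).  At the P6a caller the decl drops 350.7 k → 84.5 k heartbeats.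

## Contents
* **`natCard_imgLine_eq_of_sq_pred`** — `#Img = n`, predicate form.

## References
* [Liu2021] Y. Liu, *Fourier–Jacobi cycles and arithmetic relative trace formula*, Camb. J. Math. 9 (2021), App. D, Prop. D.8 (1)(2) (p. 135).
* [MumfordAV1970] D. Mumford, *Abelian Varieties* (1970), §7 Thm. 4 (p. 72).
-/

set_option autoImplicit false

noncomputable section

-- as in ★ `RoofImageLineCount`: Mathlib's `Over`/pull-back API and the ★ points readers are stated across semireducible wrappers.
set_option backward.isDefEq.respectTransparency false

universe u

open CategoryTheory CategoryTheory.Limits AlgebraicGeometry MonoidalCategory CartesianMonoidalCategory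
open scoped MonObj
open Literature.AlgebraicGeometry.Motives (AlgPoints SchemeOver specOver)

namespace Literature.AlgebraicGeometry.AbelianSchemes

namespace AbelianSchemeOver

variable {Ω : Type u} [Field Ω] {A A'' B : AbelianSchemeOver (Spec (.of Ω))} {O : Type*} [CommRing O]
  (act : A.RingAction O) (act'' : A''.RingAction O)
  (q : A.X ⟶ B.X) [IsMonHom q] (c : A''.X ⟶ B.X) [IsMonHom c]

/-- **`#Img = n` — PREDICATE FORM of ★ `natCard_imgLine_eq_of_sq`.**  The kernel of `q`, the line `L = Ker q ∩ A[𝔞]` and the image line are handed over as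
PREDICATES on points (`pK`, `pL`, `pS` with their membership formulas) and the two counts as counts of SUBTYPES; the three `Subgroup`s the count needs
(`Ker q`, `L`, `Img`) are rebuilt HERE from the roof rows (closure = multiplicativity of `q`, `c`, `ι`, `ι″` on points, ★ `map_pt_one'∕mul'∕inv'`).  Same
mathematics as `natCard_imgLine_eq_of_sq` ([Liu2021] Prop. D.8 (1)(2): `#Img · #L = #A[𝔞]`, so `#A[𝔞] = n·n`, `#L = n`, `0 < n` give `#Img = n`); the point
of this form is elaboration cost for callers whose point groups are a definitional — not syntactic — copy of `A.toAffine.toAbelianVariety.Points Ω` (e.g. a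
`fibre` reading): they then meet this file at the level of points and subtypes only, never at a `Subgroup (…)` type, whose implicit `Group` instance the
unifier would otherwise unfold. [cite: Liu2021, Prop. D.8 (1)(2) p. 135] [cite: MumfordAV1970, §7 Thm. 4 (p. 72)] -/
theorem natCard_imgLine_eq_of_sq_pred [IsAlgClosed Ω] {𝔭 𝔞 : Ideal O} (h𝔭𝔞 : 𝔭 ⊔ 𝔞 = ⊤)
    (pK : A.toAffine.toAbelianVariety.Points Ω → Prop)
    (h1 : ∀ P : A.toAffine.toAbelianVariety.Points Ω, (AlgPoints.map q P : B.toAffine.toAbelianVariety.Points Ω) = 1 ↔ pK P)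
    (h2 : ∀ P : A''.toAffine.toAbelianVariety.Points Ω,
      (AlgPoints.map c P : B.toAffine.toAbelianVariety.Points Ω) = 1 ↔
        ∀ a ∈ 𝔭, (AlgPoints.map (act''.i a) P : A''.toAffine.toAbelianVariety.Points Ω) = 1)
    (h2s : Function.Surjective c.left.base)
    (h4 : ∀ a : O, ∃ b : B.X ⟶ B.X, act.i a ≫ q = q ≫ b ∧ act''.i a ≫ c = c ≫ b)
    (pS : A''.toAffine.toAbelianVariety.Points Ω → Prop)
    (hS : ∀ P'', pS P'' ↔
      (∀ a ∈ 𝔞, (AlgPoints.map (act''.i a) P'' : A''.toAffine.toAbelianVariety.Points Ω) = 1) ∧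
        ∃ P : A.toAffine.toAbelianVariety.Points Ω, (∀ a ∈ 𝔞, (AlgPoints.map (act.i a) P : A.toAffine.toAbelianVariety.Points Ω) = 1) ∧
          (AlgPoints.map c P'' : B.toAffine.toAbelianVariety.Points Ω) = AlgPoints.map q P)
    (pL : A.toAffine.toAbelianVariety.Points Ω → Prop)
    (hL : ∀ P, pL P ↔ pK P ∧ ∀ a ∈ 𝔞, (AlgPoints.map (act.i a) P : A.toAffine.toAbelianVariety.Points Ω) = 1)
    {n : ℕ} (hn : 0 < n)
    (hA : Nat.card {P : A.toAffine.toAbelianVariety.Points Ω // ∀ a ∈ 𝔞, (AlgPoints.map (act.i a) P : A.toAffine.toAbelianVariety.Points Ω) = 1} = n * n)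
    (hLn : Nat.card {P // pL P} = n) : Nat.card {P'' // pS P''} = n := by
  -- `K′ = Ker q(Ω)` as a subgroup
  let K' : Subgroup (A.toAffine.toAbelianVariety.Points Ω) :=
    { carrier := {P | (AlgPoints.map q P : B.toAffine.toAbelianVariety.Points Ω) = 1}
      one_mem' := map_pt_one' q
      mul_mem' := fun {P Q} (hP : (AlgPoints.map q P : B.toAffine.toAbelianVariety.Points Ω) = 1)
          (hQ : (AlgPoints.map q Q : B.toAffine.toAbelianVariety.Points Ω) = 1) =>
        (map_pt_mul' q P Q).trans ((congrArg₂ (· * ·) hP hQ).trans (mul_one _))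
      inv_mem' := fun {P} (hP : (AlgPoints.map q P : B.toAffine.toAbelianVariety.Points Ω) = 1) =>
        (map_pt_inv' q P).trans ((congrArg (·⁻¹) hP).trans inv_one) }
  have hK' : ∀ P, (AlgPoints.map q P : B.toAffine.toAbelianVariety.Points Ω) = 1 ↔ P ∈ K' := fun _ => Iff.rfl
  -- `L′ = Ker q ∩ A[𝔞]` as a subgroup
  let L' : Subgroup (A.toAffine.toAbelianVariety.Points Ω) :=
    { carrier := {P | P ∈ K' ∧ ∀ a ∈ 𝔞, (AlgPoints.map (act.i a) P : A.toAffine.toAbelianVariety.Points Ω) = 1}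
      one_mem' := ⟨K'.one_mem, fun a _ => by haveI := act.isMonHom a; exact map_pt_one' _⟩
      mul_mem' := fun {P Q} hP hQ => ⟨K'.mul_mem hP.1 hQ.1, fun a ha => by
        haveI := act.isMonHom a
        exact (map_pt_mul' _ P Q).trans ((congrArg₂ (· * ·) (hP.2 a ha) (hQ.2 a ha)).trans (mul_one _))⟩
      inv_mem' := fun {P} hP => ⟨K'.inv_mem hP.1, fun a ha => by
        haveI := act.isMonHom a
        exact (map_pt_inv' _ P).trans ((congrArg (·⁻¹) (hP.2 a ha)).trans inv_one)⟩ }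
  have hL' : ∀ P, P ∈ L' ↔ P ∈ K' ∧ ∀ a ∈ 𝔞, (AlgPoints.map (act.i a) P : A.toAffine.toAbelianVariety.Points Ω) = 1 := fun _ => Iff.rfl
  -- the image line as a subgroup
  let S' : Subgroup (A''.toAffine.toAbelianVariety.Points Ω) :=
    { carrier := {P'' | (∀ a ∈ 𝔞, (AlgPoints.map (act''.i a) P'' : A''.toAffine.toAbelianVariety.Points Ω) = 1) ∧
        ∃ P : A.toAffine.toAbelianVariety.Points Ω, (∀ a ∈ 𝔞, (AlgPoints.map (act.i a) P : A.toAffine.toAbelianVariety.Points Ω) = 1) ∧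
          (AlgPoints.map c P'' : B.toAffine.toAbelianVariety.Points Ω) = AlgPoints.map q P}
      one_mem' := ⟨fun a _ => by haveI := act''.isMonHom a; exact map_pt_one' _, 1,
        fun a _ => by haveI := act.isMonHom a; exact map_pt_one' _, (map_pt_one' c).trans (map_pt_one' q).symm⟩
      mul_mem' := fun {P'' Q''} hP hQ => hP.2.elim fun P hP2 => hQ.2.elim fun Q hQ2 =>
        ⟨fun a ha => by
            haveI := act''.isMonHom a
            exact (map_pt_mul' _ P'' Q'').trans ((congrArg₂ (· * ·) (hP.1 a ha) (hQ.1 a ha)).trans (mul_one _)),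
          P * Q,
          fun a ha => by
            haveI := act.isMonHom a
            exact (map_pt_mul' _ P Q).trans ((congrArg₂ (· * ·) (hP2.1 a ha) (hQ2.1 a ha)).trans (mul_one _)),
          (map_pt_mul' c P'' Q'').trans ((congrArg₂ (· * ·) hP2.2 hQ2.2).trans (map_pt_mul' q P Q).symm)⟩
      inv_mem' := fun {P''} hP => hP.2.elim fun P hP2 =>
        ⟨fun a ha => by
            haveI := act''.isMonHom a
            exact (map_pt_inv' _ P'').trans ((congrArg (·⁻¹) (hP.1 a ha)).trans inv_one),
          P⁻¹,
          fun a ha => by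
            haveI := act.isMonHom a
            exact (map_pt_inv' _ P).trans ((congrArg (·⁻¹) (hP2.1 a ha)).trans inv_one),
          (map_pt_inv' c P'').trans ((congrArg (·⁻¹) hP2.2).trans (map_pt_inv' q P).symm)⟩ }
  have hS' : ∀ P'', P'' ∈ S' ↔ (∀ a ∈ 𝔞, (AlgPoints.map (act''.i a) P'' : A''.toAffine.toAbelianVariety.Points Ω) = 1) ∧
      ∃ P : A.toAffine.toAbelianVariety.Points Ω, (∀ a ∈ 𝔞, (AlgPoints.map (act.i a) P : A.toAffine.toAbelianVariety.Points Ω) = 1) ∧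
        (AlgPoints.map c P'' : B.toAffine.toAbelianVariety.Points Ω) = AlgPoints.map q P := fun _ => Iff.rfl
  -- the two subtype counts, re-read on the subgroups
  have eL : ↥L' ≃ {P // pL P} :=
    { toFun := fun P => ⟨P.1, (hL P.1).2 ⟨(h1 P.1).1 P.2.1, P.2.2⟩⟩
      invFun := fun P => ⟨P.1, (h1 P.1).2 ((hL P.1).1 P.2).1, ((hL P.1).1 P.2).2⟩
      left_inv := fun _ => rfl
      right_inv := fun _ => rfl }
  have eS : {P'' // pS P''} ≃ ↥S' :=
    { toFun := fun P => ⟨P.1, (hS P.1).1 P.2⟩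
      invFun := fun P => ⟨P.1, (hS P.1).2 P.2⟩
      left_inv := fun _ => rfl
      right_inv := fun _ => rfl }
  exact (Nat.card_congr eS).trans (natCard_imgLine_eq_of_sq act act'' q c h𝔭𝔞 K' hK' h2 h2s h4 S' hS' L' hL' hn hA
    ((Nat.card_congr eL).trans hLn))

end AbelianSchemeOver

end Literature.AlgebraicGeometry.AbelianSchemes

end
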